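import Summits.QuantumFields.BalabanUV.T4Continuum.Support.NE7FramePotL1
import Summits.QuantumFields.BalabanUV.T4Continuum.Support.NE7FramePotCurvedL1
import Summits.QuantumFields.BalabanUV.T4Continuum.Support.NE7CoarseCurvatureLetter
import Summits.QuantumFields.BalabanUV.T4Continuum.Support.NE3DirIterMajorant
import Literature.MathematicalPhysics.QuantumFieldTheory.Balaban1983to89.B6MemberOfCubeV1
import HarnessLib

/-!
# NE7TangentCorrectorLocal — THE CORNER GAUGE CORRECTOR OF `NE7FramePotL1` WITH A LOCALISED `ℓ¹` COST: (§1) the tangent field `Y` built from a skew periodic `Y₁`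
# of vanishing straight average satisfies `‖Y‖_{1,B} ≤ ‖Y₁‖_{1,B} + Σ_{x∈B,κ}(‖Λ(x+e_κ)‖ + ‖Λ x‖)` for EVERY finite set of sites `B` (`Λ` the corner lift of the frame
# potential); (§2) the frame potential at corners FAR (torus block distance `≥ ℓ + nbRad`) from a centre is bounded in `ℓ¹` by `2dL` times the `ℓ¹` mass of `Y₁` on
# the fine sites far by `≥ ℓ` — row NE3's local majorant `frameMaj` (`norm_framePotW_le_frameMaj`, `frameMaj_congr_of_l1`) and its periodic sum
# (`NE7FramePotCurvedL1.sum_periodBox_frameMaj_le` at class radius `0`)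

Cell `pub-balaban`, rung (B)+1 sub-cell t4, lineage `b2b-balaban-t4-ne7-p1` (CRUX PROVER NE7 #1 = OWNER of row NE7), generation 89; memo
`t4/b2b-balaban-t4-ne7-p1-g89/COSTING-N1.md` §5 (1).  File F254a (the T4-side ingredients of the localised slice solver letter; F254b `NE7SliceGreenFlatLocalised` is the
END).  Over `NE7FramePotL1.exists_tangent_of_straight_zero` (construction re-run with the extra export), row NE3's `NE3DirIterMajorant` (`frameMaj`, its locality and
monotonicity), `NE3TangentCovariantTower.framePotW_flat`, `NE3QuadRemainderLocality.depRad_add_le`, `NE7FramePotCurvedL1.sum_periodBox_frameMaj_le`,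
`NE7CoarseCurvatureLetter.prop1Radius_zero ∕ levelSmall_zero`, lit-balaban's torus-distance bookkeeping (`B6MemberOfCubeV1.torusSupNorm_sub_le`,
`B4TorusKernel.MultiPeriod.circAbs_le_abs ∕ circAbs_add_mul`).

WHY.  G3 `NE7SliceGreenFlat` transfers the T4 hypothesis «`|hess 1 X Y| ≤ g‖Y‖₁` on skew periodic tangent `Y`» to lit-balaban's torus through the test directions `Y^{a}`
of G3a, which have straight average zero but are tangent only after `NE7FramePotL1`'s corner gauge correction, whose `ℓ¹` cost there is GLOBAL.  The localised letter
(F252's `hGloc`, torus core F253b) reads TWO-REGION norms `a‖Y‖_{1,Bn} + b‖Y‖_{1,Bf}`; to keep the far density `b` attached to far test fields the corrector's cost must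
be LOCAL: the corner lift `Λ` is supported on block corners with value `framePot L (k+1) Y₁ z`, which depends on `Y₁` within `nbRad` blocks of the corner (row NE3's
dependency radius `depRad ≤ nbRad·L^{k+1}`), so far corners are paid by the far mass of `Y₁`, with a `k`-UNIFORM constant (`2dL`: at class radius `0` the majorant's
series is geometric with ratio `L∕L^d ≤ ½`).
WHAT ([folklore]; 0 def, 0 sorry).
§1 **`exists_tangent_of_straight_zero_local`** — `NE7FramePotL1.exists_tangent_of_straight_zero` with the `ℓ¹` clause replaced by the LOCAL one (every finite `B`; the
   corner lift written out: `Λ x = framePot L (k+1) Y₁ (x ∕ L^{k+1})` if `L^{k+1} ∣ x`, else `0`).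
§2 `far_of_l1_le` (a fine site within the dependency ball of a far corner is far), `frameMaj_series_zero_le` (the majorant's constant at radius `0` is `≤ 2dL`),
   **`sum_norm_framePot_far_le`** — `Σ_{z ∈ [0,N)^d, ℓ+nbRad ≤ |z − c|_T} ‖framePot L (k+1) Y₁ z‖ ≤ 2dL · Σ_{y ∈ [0,L^{k+1}N)^d, ℓ ≤ |⌊y∕L^{k+1}⌋ − c|_T} Σ_μ ‖Y₁ y μ‖`
   for every `(L^{k+1}N)`-periodic `Y₁`, centre `c ∈ ℤ^d`, threshold `ℓ` (`d ≥ 2`, `L ≥ 2`, `N ≥ 1`; `|·|_T` the torus sup-distance of period `N`).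
HONEST FRAMING (page 1): lattice bookkeeping over row NE3's majorants; nothing of Bałaban's asserted; NOT (APE), NOT ONE-STEP, NOT NE7; spine 0∕9; finite T⁴ rung (B)+1 —
NOT infinite volume, NOT mass gap, NOT `BetaPertH`, NOT Clay.  Continuum YM on T⁴ ⇐ BetaPertH ∧ nine spine estimates (0/9 proved); BetaPertH ⇐ (D1) ∧ (D4) ∧ CAP+tail;
G-an2-4 gates asym, D1 and NE2/3/4.
-/

set_option autoImplicit false

open scoped BigOperators Matrix Matrix.Norms.L2Operator
open Finset

namespace Summit.QuantumFields.BalabanUV.T4Continuum.NE7TangentCorrectorLocal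

open Literature.MathematicalPhysics.QuantumFieldTheory.Balaban1983to89
open B7Prop1Explicit (Site e e_apply boxVec l1)
open T4AveragingDeficitWall (IsUnitaryCfg IsSkewDir SmallField curlAt dirL1 box flat_mem_classes)
open T4AveragingDeficitWallBoundary (periodBox mem_periodBox sum_blocks_eq blockSites_periodBox sum_periodBox_shift)
open AveragingDeficitPeriodicCounting (IsPeriodicDir sum_periodBox_box_le)
open AveragingDeficitMultiLevelPrep (LevelSmall)
open AveragingDeficitTwoLevelPrep (prop1Radius)
open BlockAveragePushDirSplit (flat)
open BlockAverageVaryHolo (nbRad)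
open SmoothRefineNeutral (Tcoarse)
open NE3TangentNoGoWords (dPot)
open NE3TangentFlatStructure (Qcoarse Fcoarse framePot iterate_Tcoarse_eq' Tcoarse_dPot framePot_add_period iterate_Qcoarse_add_period
  dPot_add_period)
open NE3TangentCovariantTower (dirIter dirIter_flat framePotW framePotW_flat)
open NE3FramePotBound (isUnitaryCfg_flat geom_sum_le_inv)
open NE3SmoothRightInverseCurl (curlAt_flat_dPot curlAt_flat_add)
open NE3HessBounds (curlAt_mem_skewAdjoint)
open NE3QuadRemainderLocality (depRad depRad_add_le)
open NE3QbarIterMajorant (wlin)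
open NE3DirIterMajorant (frameMaj norm_framePotW_le_frameMaj frameMaj_congr_of_l1 frameMaj_nonneg)
open NE7FlatSkewSlice (skewPart skewPartM_zero' isSkewDir_skewPart isPeriodicDir_skewPart norm_skewPart_le curlAt_flat_skewPart skewPartM_eq_self
  dirIter_flat_skewPart)
open NE7FlatSkewSliceSolvable (dirIter_flat_add)
open NE7FramePotL1 (iterate_Tcoarse_dPot sum_norm_framePot_le)
open NE7FramePotCurvedL1 (sum_periodBox_frameMaj_le)
open NE7CoarseCurvatureLetter (prop1Radius_zero levelSmall_zero)
open B4TorusKernel.MultiPeriod (torusSupNorm torusSupNorm_nonneg circAbs circAbs_le_abs circAbs_add_mul)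
open B6MemberOfCubeV1 (torusSupNorm_sub_le)

noncomputable section

variable {d : ℕ} {n : Type*} [Fintype n] [DecidableEq n]

/-! ## §1 The corner gauge corrector with a localised `ℓ¹` cost -/

/-- **THE CORNER GAUGE CORRECTOR, LOCALISED COST** (`d ≥ 2`, `L ≥ 2`, `N ≥ 1`): for `Y₁` skew, `(L^{k+1}N)`-periodic with `(Qcoarse L)^[k+1] Y₁ = 0` there is `Y` skew,
`(L^{k+1}N)`-periodic, with `dirIter L (k+1) 1 Y = 0`, the SAME flat curl, and for EVERY finite set of sites `B`:
`‖Y‖_{1,B} ≤ ‖Y₁‖_{1,B} + Σ_{x∈B} Σ_κ (‖Λ(x + e_κ)‖ + ‖Λ x‖)`, where `Λ` is the corner lift of the frame potential (`framePot L (k+1) Y₁ (x∕L^{k+1})` at the corners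
`x ∈ L^{k+1}ℤ^d`, `0` elsewhere).  Construction as `NE7FramePotL1.exists_tangent_of_straight_zero` (`Y = skewPart (Y₁ + dPot Λ)`). [folklore] -/
theorem exists_tangent_of_straight_zero_local [Nonempty n] {L : ℕ} (hL : 2 ≤ L) (k : ℕ) {N : ℕ}
    {Y₁ : Site d → Fin d → Matrix n n ℂ} (hY₁s : IsSkewDir Y₁) (hY₁P : IsPeriodicDir Y₁ ((L ^ (k + 1) * N : ℕ) : ℤ))
    (hQ : (Qcoarse L)^[k + 1] Y₁ = 0) :
    ∃ Y : Site d → Fin d → Matrix n n ℂ, IsSkewDir Y ∧ IsPeriodicDir Y ((L ^ (k + 1) * N : ℕ) : ℤ) ∧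
      dirIter L (k + 1) (flat (d := d) (n := n)) Y = 0 ∧
      (∀ (z : Site d) (μ ν : Fin d), curlAt (flat (d := d) (n := n)) Y z μ ν = curlAt (flat (d := d) (n := n)) Y₁ z μ ν) ∧
      ∀ B : Finset (Site d), dirL1 Y B ≤ dirL1 Y₁ B + ∑ x ∈ B, ∑ κ : Fin d,
        (‖(fun x : Site d => if ∀ i, ((L ^ (k + 1) : ℕ) : ℤ) ∣ x i then framePot L (k + 1) Y₁ (fun i => x i / ((L ^ (k + 1) : ℕ) : ℤ)) else 0) (x + e κ)‖
          + ‖(fun x : Site d => if ∀ i, ((L ^ (k + 1) : ℕ) : ℤ) ∣ x i then framePot L (k + 1) Y₁ (fun i => x i / ((L ^ (k + 1) : ℕ) : ℤ)) else 0) x‖) := by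
  classical
  have hL1 : 1 ≤ L := by omega
  have hn₀1 : 1 ≤ L ^ (k + 1) := Nat.one_le_pow _ _ (by omega)
  have hn₀z : ((L ^ (k + 1) : ℕ) : ℤ) ≠ 0 := by exact_mod_cast (show L ^ (k + 1) ≠ 0 by omega)
  -- the frame potential is `N`-periodic
  have hGP : ∀ (z : Site d) (τ : Fin d), framePot L (k + 1) Y₁ (z + (N : ℤ) • e τ) = framePot L (k + 1) Y₁ z :=
    framePot_add_period L (k + 1) Y₁ (P := (N : ℤ)) (fun y τ μ => by have := hY₁P y τ μ; push_cast at this; exact this)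
  -- the corner lift
  set Λ : Site d → Matrix n n ℂ :=
    fun x => if ∀ i, ((L ^ (k + 1) : ℕ) : ℤ) ∣ x i then framePot L (k + 1) Y₁ (fun i => x i / ((L ^ (k + 1) : ℕ) : ℤ)) else 0 with hΛ
  have hΛcorner : ∀ z : Site d, Λ (((L ^ (k + 1) : ℕ) : ℤ) • z) = framePot L (k + 1) Y₁ z := by
    intro z
    have hdiv : ∀ i, ((L ^ (k + 1) : ℕ) : ℤ) ∣ ((((L ^ (k + 1) : ℕ) : ℤ)) • z) i := fun i => ⟨z i, by simp⟩
    have hLz : (L : ℤ) ^ (k + 1) ≠ 0 := pow_ne_zero _ (by exact_mod_cast (show L ≠ 0 by omega))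
    simp only [hΛ]
    rw [if_pos hdiv]
    congr 1
    funext i
    simp only [Pi.smul_apply, smul_eq_mul]
    push_cast
    exact Int.mul_ediv_cancel_left (z i) hLz
  have hΛP : ∀ (x : Site d) (τ : Fin d), Λ (x + ((L ^ (k + 1) * N : ℕ) : ℤ) • e τ) = Λ x := by
    intro x τ
    have hiff : (∀ i, ((L ^ (k + 1) : ℕ) : ℤ) ∣ (x + ((L ^ (k + 1) * N : ℕ) : ℤ) • e τ) i) ↔ ∀ i, ((L ^ (k + 1) : ℕ) : ℤ) ∣ x i := by
      refine forall_congr' fun i => ?_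
      simp only [Pi.add_apply, Pi.smul_apply, smul_eq_mul, Nat.cast_mul]
      rw [show ((L ^ (k + 1) : ℕ) : ℤ) * N * e τ i = ((L ^ (k + 1) : ℕ) : ℤ) * (N * e τ i) by ring]
      exact dvd_add_left (Dvd.intro _ rfl)
    by_cases hx : ∀ i, ((L ^ (k + 1) : ℕ) : ℤ) ∣ x i
    · have hx' := hiff.mpr hx
      simp only [hΛ]
      rw [if_pos hx, if_pos hx']
      have hq : (fun i => (x + ((L ^ (k + 1) * N : ℕ) : ℤ) • e τ) i / ((L ^ (k + 1) : ℕ) : ℤ))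
          = (fun i => x i / ((L ^ (k + 1) : ℕ) : ℤ)) + (N : ℤ) • e τ := by
        funext i
        simp only [Pi.add_apply, Pi.smul_apply, smul_eq_mul, Nat.cast_mul]
        rw [show ((L ^ (k + 1) : ℕ) : ℤ) * N * e τ i = ((L ^ (k + 1) : ℕ) : ℤ) * (N * e τ i) by ring, Int.add_mul_ediv_left _ _ hn₀z]
      rw [hq, hGP]
    · have hx' : ¬ ∀ i, ((L ^ (k + 1) : ℕ) : ℤ) ∣ (x + ((L ^ (k + 1) * N : ℕ) : ℤ) • e τ) i := fun h => hx (hiff.mp h)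
      simp only [hΛ]
      rw [if_neg hx, if_neg hx']
  -- the corrected field and its skew part
  refine ⟨skewPart (Y₁ + dPot Λ), isSkewDir_skewPart _, ?_, ?_, ?_, ?_⟩
  · -- periodic
    refine isPeriodicDir_skewPart fun x κ μ => ?_
    rw [Pi.add_apply, Pi.add_apply, hY₁P x κ μ]
    congr 1
    exact dPot_add_period hΛP x κ μ
  · -- tangent
    rw [dirIter_flat_skewPart hL1, dirIter_flat_add hL1, dirIter_flat hL1, dirIter_flat hL1, iterate_Tcoarse_eq' hL1, hQ,
      iterate_Tcoarse_dPot hL1]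
    have hc : (fun w : Site d => Λ (((L : ℤ) ^ (k + 1)) • w)) = framePot L (k + 1) Y₁ := by
      funext w; rw [← hΛcorner w]; push_cast; rfl
    have hsum : ((fun z κ => (0 : Site d → Fin d → Matrix n n ℂ) z κ - dPot (framePot L (k + 1) Y₁) z κ)
        + dPot fun w => Λ (((L : ℤ) ^ (k + 1)) • w)) = 0 := by
      rw [hc]
      funext z κ
      simp only [Pi.add_apply, Pi.zero_apply, zero_sub, neg_add_cancel]
    rw [hsum]
    funext z κ
    exact skewPartM_zero'
  · -- same curl
    intro z μ ν
    rw [curlAt_flat_skewPart, curlAt_flat_add, curlAt_flat_dPot, add_zero]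
    exact skewPartM_eq_self (curlAt_mem_skewAdjoint isUnitaryCfg_flat hY₁s z μ ν)
  · -- the LOCAL `ℓ¹` cost
    intro B
    calc dirL1 (skewPart (Y₁ + dPot Λ)) B
        ≤ dirL1 (Y₁ + dPot Λ) B :=
          Finset.sum_le_sum fun x _ => Finset.sum_le_sum fun κ _ => norm_skewPart_le _ x κ
      _ ≤ dirL1 Y₁ B + dirL1 (dPot Λ) B := by
          unfold dirL1
          rw [← Finset.sum_add_distrib]
          refine Finset.sum_le_sum fun x _ => ?_
          rw [← Finset.sum_add_distrib]
          exact Finset.sum_le_sum fun κ _ => norm_add_le _ _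
      _ ≤ dirL1 Y₁ B + ∑ x ∈ B, ∑ κ : Fin d, (‖Λ (x + e κ)‖ + ‖Λ x‖) := by
          unfold dirL1
          refine add_le_add le_rfl (Finset.sum_le_sum fun x _ => Finset.sum_le_sum fun κ _ => ?_)
          unfold dPot
          exact norm_sub_le _ _

/-! ## §2 The frame potential at far corners is paid by the far mass of the field -/

/-- **THE MAJORANT'S CONSTANT AT CLASS RADIUS `0` IS `≤ 2dL`** (`d ≥ 2`, `L ≥ 2`): every factor of `NE7FramePotCurvedL1.sum_periodBox_frameMaj_le`'s product is
`L∕L^d ≤ ½` (`prop1Radius^[l] 0 = 0`, `wlin d L 0 = 0`), so the series is geometric. [folklore] -/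
theorem frameMaj_series_zero_le (hd : 2 ≤ d) {L : ℕ} (hL : 2 ≤ L) (k : ℕ) :
    ((d : ℝ) * L) * ∑ i ∈ Finset.range (k + 1), ∏ l ∈ Finset.range i, ((L : ℝ) / (L : ℝ) ^ d
        + (d : ℝ) * wlin d L ((prop1Radius d L)^[l] 0) * (1250 * ((nbRad d L : ℝ) + L) + 8 * ((d : ℝ) * L) + 2 * L))
      ≤ 2 * ((d : ℝ) * L) := by
  have hLr : (2 : ℝ) ≤ L := by exact_mod_cast hL
  set q : ℝ := (L : ℝ) / (L : ℝ) ^ d with hq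
  have hq0 : 0 ≤ q := by positivity
  have hq1 : q ≤ 1 / 2 := by
    rw [hq, div_le_iff₀ (by positivity)]
    obtain ⟨d', rfl⟩ : ∃ d', d = d' + 2 := ⟨d - 2, by omega⟩
    have h1 : (1 : ℝ) ≤ (L : ℝ) ^ d' := one_le_pow₀ (by linarith)
    rw [pow_add, pow_two]
    nlinarith [mul_le_mul h1 hLr (by norm_num) (by positivity)]
  have hq1' : q < 1 := by linarith
  have hfac : ∀ l : ℕ, q + (d : ℝ) * wlin d L ((prop1Radius d L)^[l] 0) * (1250 * ((nbRad d L : ℝ) + L) + 8 * ((d : ℝ) * L) + 2 * L) = q := by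
    intro l
    rw [Function.iterate_fixed (prop1Radius_zero (d := d) L) l]
    simp [wlin]
  simp only [hfac, Finset.prod_const, Finset.card_range]
  have hgeom := geom_sum_le_inv hq0 hq1' (k + 1)
  have h2 : 1 / (1 - q) ≤ 2 := by rw [div_le_iff₀ (by linarith)]; linarith
  have hdL : (0 : ℝ) ≤ (d : ℝ) * L := by positivity
  nlinarith [hgeom.trans h2]

section Far

variable (N : ℕ) [NeZero N]

/-- on the dependency ball of a corner the integer-division block coordinates are within `nbRad` of the corner's. [folklore] -/
theorem abs_ediv_sub_le_of_l1_le {L : ℕ} (hL : 2 ≤ L) (k : ℕ) (z y : Site d)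
    (hy : l1 (y - ((L : ℤ) ^ (k + 1)) • z) ≤ depRad d L (k + 1)) (i : Fin d) :
    |y i / ((L ^ (k + 1) : ℕ) : ℤ) - z i| ≤ (nbRad d L : ℤ) := by
  set M : ℤ := ((L ^ (k + 1) : ℕ) : ℤ) with hM
  have hM1 : 1 ≤ L ^ (k + 1) := Nat.one_le_pow _ _ (by omega)
  have hMpos : 0 < M := by rw [hM]; exact_mod_cast hM1
  -- the coordinate is within `depRad < nbRad·M` of the corner coordinate
  have hcoord : ((y - ((L : ℤ) ^ (k + 1)) • z) i).natAbs ≤ depRad d L (k + 1) :=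
    (Finset.single_le_sum (f := fun κ => ((y - ((L : ℤ) ^ (k + 1)) • z) κ).natAbs) (fun _ _ => Nat.zero_le _) (Finset.mem_univ i)).trans hy
  have hdep : depRad d L (k + 1) + nbRad d L ≤ nbRad d L * L ^ (k + 1) := depRad_add_le hL (k + 1)
  set r : ℤ := y i - M * z i with hr
  have hri : (y - ((L : ℤ) ^ (k + 1)) • z) i = r := by
    simp only [Pi.sub_apply, Pi.smul_apply, smul_eq_mul, hr, hM]; push_cast; ring
  rw [hri] at hcoord
  have hrabs : |r| ≤ (nbRad d L : ℤ) * M - nbRad d L := by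
    have h1 : (r.natAbs : ℤ) ≤ depRad d L (k + 1) := by exact_mod_cast hcoord
    have h2 : ((depRad d L (k + 1) : ℕ) : ℤ) + nbRad d L ≤ (nbRad d L : ℤ) * ((L ^ (k + 1) : ℕ) : ℤ) := by exact_mod_cast hdep
    rw [Int.abs_eq_natAbs]
    rw [hM]; linarith
  have hnb1 : (1 : ℤ) ≤ nbRad d L := by
    have h1 : 1 ≤ nbRad d L := by unfold nbRad; nlinarith [hL]
    exact_mod_cast h1
  have hlt : r < (nbRad d L : ℤ) * M := by
    have := (abs_le.mp hrabs).2
    linarith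
  have hge : -((nbRad d L : ℤ) * M) ≤ r := by
    have := (abs_le.mp hrabs).1
    nlinarith
  -- divide
  have hyi : y i / M = r / M + z i := by
    have : y i = r + z i * M := by rw [hr]; ring
    rw [this, Int.add_mul_ediv_right _ _ hMpos.ne']
  rw [hyi, add_sub_cancel_right, abs_le]
  constructor
  · rw [Int.le_ediv_iff_mul_le hMpos]; linarith
  · have : r / M < nbRad d L := by rw [Int.ediv_lt_iff_lt_mul hMpos]; linarith
    linarith

/-- **A FINE SITE IN THE DEPENDENCY BALL OF A FAR CORNER IS FAR**: if `l1 (y − L^{k+1}•z) ≤ depRad d L (k+1)` and `z` is at torus block-distance `≥ ℓ + nbRad` from the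
centre `c` (period `N`), then the block `⌊y∕L^{k+1}⌋` is at torus block-distance `≥ ℓ` from `c`. [folklore] -/
theorem far_of_l1_le {L : ℕ} (hL : 2 ≤ L) (k : ℕ) (c z y : Site (d + 1)) {ℓ : ℝ}
    (hz : ℓ + nbRad (d + 1) L ≤ torusSupNorm (fun _ : Fin (d + 1) => N) (z - c))
    (hy : l1 (y - ((L : ℤ) ^ (k + 1)) • z) ≤ depRad (d + 1) L (k + 1)) :
    ℓ ≤ torusSupNorm (fun _ : Fin (d + 1) => N) ((fun i => y i / ((L ^ (k + 1) : ℕ) : ℤ)) - c) := by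
  have hN1 : ∀ i : Fin (d + 1), 1 ≤ (fun _ : Fin (d + 1) => N) i := fun _ => Nat.one_le_iff_ne_zero.mpr (NeZero.ne N)
  -- the block of `y` is within `nbRad` of `z`
  have hnear : torusSupNorm (fun _ : Fin (d + 1) => N) (z - fun i => y i / ((L ^ (k + 1) : ℕ) : ℤ)) ≤ nbRad (d + 1) L := by
    unfold torusSupNorm
    refine Finset.sup'_le _ _ fun i _ => ?_
    have h1 := circAbs_le_abs (hN1 i) ((z - fun j => y j / ((L ^ (k + 1) : ℕ) : ℤ)) i)
    have h2 : |(z - fun j => y j / ((L ^ (k + 1) : ℕ) : ℤ)) i| ≤ (nbRad (d + 1) L : ℤ) := by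
      rw [Pi.sub_apply, abs_sub_comm]
      exact abs_ediv_sub_le_of_l1_le hL k z y hy i
    exact_mod_cast h1.trans h2
  have htri := torusSupNorm_sub_le hN1 z (fun i => y i / ((L ^ (k + 1) : ℕ) : ℤ)) c
  linarith

/-- **THE FRAME POTENTIAL AT FAR CORNERS IS PAID BY THE FAR MASS OF THE FIELD** (dimension `d + 1 ≥ 2`, `L ≥ 2`, `N ≥ 1`): for `Y₁` `(L^{k+1}N)`-periodic, a centre
`c ∈ ℤ^{d+1}` and a threshold `ℓ`,
`Σ_{z ∈ [0,N)^{d+1}, |z − c|_T ≥ ℓ + nbRad} ‖framePot L (k+1) Y₁ z‖ ≤ 2(d+1)L · Σ_{y ∈ [0,L^{k+1}N)^{d+1}, |⌊y∕L^{k+1}⌋ − c|_T ≥ ℓ} Σ_μ ‖Y₁ y μ‖`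
(row NE3's `frameMaj` at the flat background and class radius `0`, its locality on the dependency ball, and its periodic sum). [folklore] -/
theorem sum_norm_framePot_far_le [Nonempty n] (hd : 1 ≤ d) {L : ℕ} (hL : 2 ≤ L) (k : ℕ)
    {Y₁ : Site (d + 1) → Fin (d + 1) → Matrix n n ℂ} (hY₁P : IsPeriodicDir Y₁ ((L ^ (k + 1) * N : ℕ) : ℤ)) (c : Site (d + 1)) (ℓ : ℝ) :
    ∑ z ∈ (periodBox (d := d + 1) N).filter (fun z => ℓ + nbRad (d + 1) L ≤ torusSupNorm (fun _ : Fin (d + 1) => N) (z - c)),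
        ‖framePot L (k + 1) Y₁ z‖
      ≤ 2 * ((((d + 1 : ℕ) : ℝ)) * L) * ∑ y ∈ (periodBox (d := d + 1) (L ^ (k + 1) * N)).filter
            (fun y => ℓ ≤ torusSupNorm (fun _ : Fin (d + 1) => N) ((fun i => y i / ((L ^ (k + 1) : ℕ) : ℤ)) - c)), ∑ μ : Fin (d + 1), ‖Y₁ y μ‖ := by
  classical
  have hL1 : 1 ≤ L := by omega
  have hMz : ((L ^ (k + 1) : ℕ) : ℤ) ≠ 0 := by exact_mod_cast (show L ^ (k + 1) ≠ 0 by positivity)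
  have hflatU : IsUnitaryCfg (flat (d := d + 1) (n := n)) := (flat_mem_classes (d := d + 1) (n := n) le_rfl).1
  have hflat0 : SmallField (flat (d := d + 1) (n := n)) 0 := (flat_mem_classes (d := d + 1) (n := n) le_rfl).2
  -- the far weight
  set ω' : Site (d + 1) → Fin (d + 1) → ℝ :=
    fun y μ => if ℓ ≤ torusSupNorm (fun _ : Fin (d + 1) => N) ((fun i => y i / ((L ^ (k + 1) : ℕ) : ℤ)) - c) then ‖Y₁ y μ‖ else 0 with hω'
  have hω'0 : ∀ y μ, 0 ≤ ω' y μ := by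
    intro y μ; simp only [hω']; split_ifs <;> simp
  have hω'P : ∀ (y : Site (d + 1)) (i μ : Fin (d + 1)), ω' (y + ((N * L ^ (k + 1) : ℕ) : ℤ) • e i) μ = ω' y μ := by
    intro y i μ
    have hY : ‖Y₁ (y + ((N * L ^ (k + 1) : ℕ) : ℤ) • e i) μ‖ = ‖Y₁ y μ‖ := by rw [Nat.mul_comm, hY₁P y i μ]
    have hdiv : (fun j => (y + ((N * L ^ (k + 1) : ℕ) : ℤ) • e i) j / ((L ^ (k + 1) : ℕ) : ℤ))
        = (fun j => y j / ((L ^ (k + 1) : ℕ) : ℤ)) + fun j => (N : ℤ) * e i j := by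
      funext j
      simp only [Pi.add_apply, Pi.smul_apply, smul_eq_mul, Nat.cast_mul]
      rw [show (N : ℤ) * ((L ^ (k + 1) : ℕ) : ℤ) * e i j = y j * 0 + ((N : ℤ) * e i j) * ((L ^ (k + 1) : ℕ) : ℤ) by ring, mul_zero, zero_add,
        Int.add_mul_ediv_right _ _ hMz]
    have htsn : torusSupNorm (fun _ : Fin (d + 1) => N) ((fun j => (y + ((N * L ^ (k + 1) : ℕ) : ℤ) • e i) j / ((L ^ (k + 1) : ℕ) : ℤ)) - c)
        = torusSupNorm (fun _ : Fin (d + 1) => N) ((fun j => y j / ((L ^ (k + 1) : ℕ) : ℤ)) - c) := by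
      rw [hdiv]
      unfold torusSupNorm
      congr 1
      funext j
      simp only [Pi.sub_apply, Pi.add_apply]
      rw [show y j / ((L ^ (k + 1) : ℕ) : ℤ) + (N : ℤ) * e i j - c j = (y j / ((L ^ (k + 1) : ℕ) : ℤ) - c j) + (N : ℤ) * e i j by ring, circAbs_add_mul]
    simp only [hω', htsn, hY]
  -- each far corner: the frame potential is bounded by the majorant of the FAR weight
  have hcorner : ∀ z ∈ (periodBox (d := d + 1) N).filter (fun z => ℓ + nbRad (d + 1) L ≤ torusSupNorm (fun _ : Fin (d + 1) => N) (z - c)),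
      ‖framePot L (k + 1) Y₁ z‖ ≤ frameMaj (d + 1) L (k + 1) 0 ω' z := by
    intro z hz
    have hzfar := (Finset.mem_filter.mp hz).2
    rw [← framePotW_flat (n := n) hL1 (k + 1) Y₁]
    have h := norm_framePotW_le_frameMaj (d := d + 1) (n := n) hL1 k hflatU le_rfl (levelSmall_zero L k) hflat0
      (Y := Y₁) (ω := fun y μ => ‖Y₁ y μ‖) (fun _ _ => le_rfl) z
    refine h.trans (le_of_eq (frameMaj_congr_of_l1 (d + 1) L (k + 1) 0 z fun y μ hy => ?_))
    simp only [hω']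
    rw [if_pos (far_of_l1_le N hL k c z y hzfar hy)]
  -- sum: far corners ≤ all corners ≤ C(k)·Σ far weight
  have hsum := sum_periodBox_frameMaj_le (d := d + 1) hL1 k N 0 le_rfl ω' hω'0 hω'P
  have hC := frameMaj_series_zero_le (d := d + 1) (by omega) hL k
  have hS0 : 0 ≤ ∑ y ∈ periodBox (d := d + 1) (N * L ^ (k + 1)), ∑ μ : Fin (d + 1), ω' y μ :=
    Finset.sum_nonneg fun _ _ => Finset.sum_nonneg fun _ _ => hω'0 _ _
  have hfar_eq : ∑ y ∈ periodBox (d := d + 1) (N * L ^ (k + 1)), ∑ μ : Fin (d + 1), ω' y μ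
      = ∑ y ∈ (periodBox (d := d + 1) (L ^ (k + 1) * N)).filter
            (fun y => ℓ ≤ torusSupNorm (fun _ : Fin (d + 1) => N) ((fun i => y i / ((L ^ (k + 1) : ℕ) : ℤ)) - c)), ∑ μ : Fin (d + 1), ‖Y₁ y μ‖ := by
    rw [Nat.mul_comm, Finset.sum_filter]
    refine Finset.sum_congr rfl fun y _ => ?_
    simp only [hω']
    split_ifs <;> simp
  calc ∑ z ∈ (periodBox (d := d + 1) N).filter (fun z => ℓ + nbRad (d + 1) L ≤ torusSupNorm (fun _ : Fin (d + 1) => N) (z - c)),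
        ‖framePot L (k + 1) Y₁ z‖
      ≤ ∑ z ∈ (periodBox (d := d + 1) N).filter (fun z => ℓ + nbRad (d + 1) L ≤ torusSupNorm (fun _ : Fin (d + 1) => N) (z - c)),
          frameMaj (d + 1) L (k + 1) 0 ω' z := Finset.sum_le_sum hcorner
    _ ≤ ∑ z ∈ periodBox (d := d + 1) N, frameMaj (d + 1) L (k + 1) 0 ω' z :=
        Finset.sum_le_sum_of_subset_of_nonneg (Finset.filter_subset _ _) fun z _ _ => frameMaj_nonneg (d + 1) L (k + 1) le_rfl hω'0 z
    _ ≤ _ := hsum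
    _ ≤ 2 * ((((d + 1 : ℕ) : ℝ)) * L) * ∑ y ∈ periodBox (d := d + 1) (N * L ^ (k + 1)), ∑ μ : Fin (d + 1), ω' y μ := by
        have := mul_le_mul_of_nonneg_right hC hS0
        push_cast at this ⊢
        linarith
    _ = _ := by rw [hfar_eq]

end Far

end

end Summit.QuantumFields.BalabanUV.T4Continuum.NE7TangentCorrectorLocal
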